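import Mathlib

/-!
# Joint multi-shell certificates — geometry of the admissible cosine (`FiniteRangeSplitting`, stmt-AtomisticToContinuum-12559)

Support algebra for the next rung of the `FreeSplittingCertificates` radius ladder (block-2b unit `b2b-freesplit-A`, gen 40).
VALUE = kernel-checked elementary geometry feeding a matrix-valued (multi-shell) Delsarte certificate — NOT summit progress.

For two points `y, z` seen from a centre, with `‖y‖ = r ∈ [a,b]`, `‖z‖ = s ∈ [a',b']` (all `≥ δ > 0`) and `δ ≤ ‖y - z‖`, the cosine of
the angle between them is at most the CORNER MAXIMUM of `φ(r,s) = (r² + s² - δ²)/(2rs)` over the box — because `φ` is convex in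
each variable on `[δ, ∞)`.  This is the admissible-range input of the off-diagonal sign conditions of the certificate.
-/

noncomputable section

namespace Summit.AtomisticToContinuum.Crystallization.Theorems.StrictSplittingRuleBirth

/-- The law-of-cosines value `φ(r,s) = (r² + s² - δ²) / (2 r s)`: the cosine of the angle at the centre of a triangle with
sides `r, s` and opposite side `δ`. -/
def cosCorner (δ r s : ℝ) : ℝ := (r ^ 2 + s ^ 2 - δ ^ 2) / (2 * r * s)

/-- `φ` is symmetric in `r, s`. -/
theorem cosCorner_comm (δ r s : ℝ) : cosCorner δ r s = cosCorner δ s r := by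
  unfold cosCorner; ring_nf

/-- `r + κ/r ≤ max (a + κ/a) (b + κ/b)` on `0 < a ≤ r ≤ b` (for `κ ≥ 0` the function is convex, for `κ < 0` increasing). -/
theorem add_div_le_max {a b r κ : ℝ} (ha : 0 < a) (har : a ≤ r) (hrb : r ≤ b) :
    r + κ / r ≤ max (a + κ / a) (b + κ / b) := by
  have hr : 0 < r := lt_of_lt_of_le ha har
  have hb : 0 < b := lt_of_lt_of_le hr hrb
  by_cases h : r * a ≤ κ
  · -- then r + κ/r ≤ a + κ/a
    refine le_trans ?_ (le_max_left _ _)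
    -- (a + κ/a) - (r + κ/r) = (r - a) (κ - r a) / (r a) ≥ 0
    have key : a + κ / a - (r + κ / r) = (r - a) * (κ - r * a) / (r * a) := by
      field_simp
      ring
    have : 0 ≤ a + κ / a - (r + κ / r) := by
      rw [key]
      exact div_nonneg (mul_nonneg (sub_nonneg.2 har) (sub_nonneg.2 h)) (mul_pos hr ha).le
    linarith
  · rw [not_le] at h
    refine le_trans ?_ (le_max_right _ _)
    have key : b + κ / b - (r + κ / r) = (b - r) * (r * b - κ) / (r * b) := by
      field_simp
      ring
    have hκ' : κ ≤ r * b := le_trans h.le (mul_le_mul_of_nonneg_left (har.trans hrb) hr.le)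
    have : 0 ≤ b + κ / b - (r + κ / r) := by
      rw [key]
      exact div_nonneg (mul_nonneg (sub_nonneg.2 hrb) (sub_nonneg.2 hκ')) (mul_pos hr hb).le
    linarith

/-- `φ(·, s)` on `[a, b] ⊆ [δ, ∞)` is bounded by its values at the endpoints (`s ≥ δ`). -/
theorem cosCorner_le_max_left {δ a b r s : ℝ} (hδ : 0 < δ) (hδa : δ ≤ a) (har : a ≤ r) (hrb : r ≤ b)
    (hδs : δ ≤ s) : cosCorner δ r s ≤ max (cosCorner δ a s) (cosCorner δ b s) := by
  have ha : 0 < a := lt_of_lt_of_le hδ hδa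
  have hs : 0 < s := lt_of_lt_of_le hδ hδs
  have e : ∀ ρ : ℝ, 0 < ρ → cosCorner δ ρ s = (ρ + (s ^ 2 - δ ^ 2) / ρ) / (2 * s) := by
    intro ρ hρ
    unfold cosCorner
    field_simp
    ring
  have H := add_div_le_max (κ := s ^ 2 - δ ^ 2) ha har hrb
  rw [e r (lt_of_lt_of_le ha har), e a ha, e b (lt_of_lt_of_le (lt_of_lt_of_le ha har) hrb)]
  have h2s : (0 : ℝ) ≤ 2 * s := by positivity
  rcases le_max_iff.1 H with h | h
  · exact le_max_of_le_left (div_le_div_of_nonneg_right h h2s)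
  · exact le_max_of_le_right (div_le_div_of_nonneg_right h h2s)

/-- The corner maximum of `φ` over the box `[a,b] × [a',b']`. -/
def cbar4 (δ a b a' b' : ℝ) : ℝ :=
  max (max (cosCorner δ a a') (cosCorner δ a b')) (max (cosCorner δ b a') (cosCorner δ b b'))

/-- `φ(r, s) ≤` its corner maximum on `[a,b] × [a',b'] ⊆ [δ,∞)²`. -/
theorem cosCorner_le_cbar4 {δ a b a' b' r s : ℝ} (hδ : 0 < δ) (hδa : δ ≤ a) (hδa' : δ ≤ a') (har : a ≤ r)
    (hrb : r ≤ b) (has : a' ≤ s) (hsb : s ≤ b') : cosCorner δ r s ≤ cbar4 δ a b a' b' := by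
  have hδs : δ ≤ s := hδa'.trans has
  have h1 := cosCorner_le_max_left hδ hδa har hrb hδs
  have hA : cosCorner δ a s ≤ max (cosCorner δ a a') (cosCorner δ a b') := by
    rw [cosCorner_comm δ a s, cosCorner_comm δ a a', cosCorner_comm δ a b']
    exact cosCorner_le_max_left hδ hδa' has hsb hδa
  have hB : cosCorner δ b s ≤ max (cosCorner δ b a') (cosCorner δ b b') := by
    rw [cosCorner_comm δ b s, cosCorner_comm δ b a', cosCorner_comm δ b b']
    exact cosCorner_le_max_left hδ hδa' has hsb (hδa.trans (har.trans hrb))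
  exact h1.trans (max_le_max hA hB)

/-! ## From distances to the cosine of unit directions -/

/-- Law of cosines as an inequality: `δ ≤ ‖y - z‖` forces `⟪y, z⟫ ≤ (‖y‖² + ‖z‖² - δ²)/2`. -/
theorem inner_le_of_le_dist {y z : EuclideanSpace ℝ (Fin 3)} {δ : ℝ} (hδ : 0 ≤ δ) (hyz : δ ≤ ‖y - z‖) :
    inner ℝ y z ≤ (‖y‖ ^ 2 + ‖z‖ ^ 2 - δ ^ 2) / 2 := by
  have h := norm_sub_sq_real y z
  have hd : δ ^ 2 ≤ ‖y - z‖ ^ 2 := pow_le_pow_left₀ hδ hyz 2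
  linarith

/-- The unit direction of a nonzero vector has norm `1`. -/
theorem norm_unitDir {y : EuclideanSpace ℝ (Fin 3)} (hy : y ≠ 0) : ‖(‖y‖⁻¹) • y‖ = 1 :=
  norm_smul_inv_norm hy

/-- The cosine of the angle between two nonzero vectors is `≥ -1`. -/
theorem neg_one_le_inner_unitDir {y z : EuclideanSpace ℝ (Fin 3)} (hy : y ≠ 0) (hz : z ≠ 0) :
    -1 ≤ inner ℝ ((‖y‖⁻¹) • y) ((‖z‖⁻¹) • z) := by
  have h := abs_real_inner_le_norm ((‖y‖⁻¹) • y) ((‖z‖⁻¹) • z)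
  rw [norm_unitDir hy, norm_unitDir hz, mul_one] at h
  exact (abs_le.1 h).1

/-- **Admissible cosine.**  If `‖y‖ ∈ [a,b]`, `‖z‖ ∈ [a',b']` (with `δ ≤ a`, `δ ≤ a'`, `0 < δ`) and `δ ≤ ‖y - z‖`, then the cosine
of the angle between `y` and `z` is at most the corner maximum `cbar4 δ a b a' b'`. -/
theorem inner_unitDir_le_cbar4 {δ a b a' b' : ℝ} {y z : EuclideanSpace ℝ (Fin 3)} (hδ : 0 < δ) (hδa : δ ≤ a)
    (hδa' : δ ≤ a') (hya : a ≤ ‖y‖) (hyb : ‖y‖ ≤ b) (hza : a' ≤ ‖z‖) (hzb : ‖z‖ ≤ b') (hyz : δ ≤ ‖y - z‖) :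
    inner ℝ ((‖y‖⁻¹) • y) ((‖z‖⁻¹) • z) ≤ cbar4 δ a b a' b' := by
  have hny : 0 < ‖y‖ := lt_of_lt_of_le hδ (hδa.trans hya)
  have hnz : 0 < ‖z‖ := lt_of_lt_of_le hδ (hδa'.trans hza)
  have hin := inner_le_of_le_dist hδ.le hyz
  have hcos : inner ℝ ((‖y‖⁻¹) • y) ((‖z‖⁻¹) • z) ≤ cosCorner δ ‖y‖ ‖z‖ := by
    rw [real_inner_smul_left, real_inner_smul_right]
    unfold cosCorner
    rw [show ‖y‖⁻¹ * (‖z‖⁻¹ * inner ℝ y z) = inner ℝ y z / (‖y‖ * ‖z‖) by field_simp]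
    rw [div_le_div_iff₀ (mul_pos hny hnz) (by positivity)]
    nlinarith [mul_pos hny hnz]
  exact hcos.trans (cosCorner_le_cbar4 hδ hδa hδa' hya hyb hza hzb)

end Summit.AtomisticToContinuum.Crystallization.Theorems.StrictSplittingRuleBirth

end
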